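import Literature.AlgebraicGeometry.Frobenioids.PadicKummerRemark221
import HarnessLib

/-!
# Frobenioids II, Remark 2.2.1 for `O^⊳_L` and `O^×_L` (root-closure discharged)

Mochizuki, *The geometry of Frobenioids II*, Kyushu J. Math. **62** (2008) 401–460, §2, Remark 2.2.1
p. 18 [cite: MochizukiFrdII2008, Rmk 2.2.1 p.18]. Proof-only companion of `PadicKummerRemark221.lean`
(abc-iut-L1-t7): the root-closure hypothesis of `saturatedInvariantsAdmitRoots_ofLocalField`
("`O^□_L` contains every `x ∈ L` with `x^N ∈ O^□_L`") HOLDS for the two monoids of Definition 2.2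
(iii), `O^⊳_L` (an `N`-th root of a nonzero integral element is nonzero integral) and `O^×_L` (an
`N`-th root of a unit is a unit), whence `SaturatedInvariantsAdmitRoots` for the contexts
`ofLocalField L H hH (triSubmonoid K L)`, `… (unitsStableSubmonoid K L)`, `… (boxStableSubmonoid K L fs)`
with NO hypothesis beyond `Gal(K̄/L) ≤ H` (`K` of characteristic `0` with a valuative structure).
No definitions; nothing here concerns [IUTchIII].
-/

namespace Literature.AlgebraicGeometry.Frobenioids

namespace PadicKummer

open Field IntermediateField
open scoped ValuativeRel
open Literature.NumberTheory.GaloisRepresentations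
open Literature.NumberTheory.GaloisRepresentations.LocalWeilDatum
open Literature.AnabelianGeometry.AbsoluteAnabelian (unitSubmonoid_le_nonzeroIntegers)

variable (K : Type) [Field K] [ValuativeRel K] (L : IntermediateField K (AlgebraicClosure K)) (N : ℕ)

/-- `O^⊳_L` is closed under `N`-th roots in `L` (`N ≥ 1`): if `x^N` is a nonzero `𝒪_K`-integral
element then so is `x` (`IsIntegral.of_pow`). [cite: MochizukiFrdII2008, Rmk 2.2.1 p.18] -/
theorem mem_triSubmonoid_of_pow_mem (hN : 0 < N) {x : L}
    (hx : x ^ N ∈ (triSubmonoid K L).toSubmonoid) : x ∈ (triSubmonoid K L).toSubmonoid := by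
  refine ⟨IsIntegral.of_pow hN hx.1, fun h => hx.2 ?_⟩
  rw [h, zero_pow hN.ne']

/-- `O^×_L` is closed under `N`-th roots in `L` (`N ≥ 1`): if `x^N` is an integral unit then so is
`x` (its inverse is `x^(N-1) · (x^N)⁻¹`). [cite: MochizukiFrdII2008, Rmk 2.2.1 p.18] -/
theorem mem_unitsStableSubmonoid_of_pow_mem (hN : 0 < N) {x : L}
    (hx : x ^ N ∈ (unitsStableSubmonoid K L).toSubmonoid) :
    x ∈ (unitsStableSubmonoid K L).toSubmonoid := by
  have hxt : x ∈ (triSubmonoid K L).toSubmonoid :=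
    mem_triSubmonoid_of_pow_mem K L N hN (unitSubmonoid_le_nonzeroIntegers hx)
  obtain ⟨_, y, hy, hxy⟩ := hx
  refine ⟨hxt.1, x ^ (N - 1) * y, ?_, ?_⟩
  · have hp : x ^ (N - 1) ∈ (triSubmonoid K L).toSubmonoid := Submonoid.pow_mem _ hxt _
    exact Subalgebra.mul_mem _ hp.1 hy
  · rw [← mul_assoc, ← pow_succ', Nat.sub_add_cancel (Nat.one_le_iff_ne_zero.mpr hN.ne'), hxy]

/-- `O^□_L` (either choice of Def. 2.2 (iii)) is closed under `N`-th roots in `L`.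
[cite: MochizukiFrdII2008, Def 2.2 (iii) p.18] -/
theorem mem_boxStableSubmonoid_of_pow_mem (fs : Prop) (hN : 0 < N) {x : L}
    (hx : x ^ N ∈ (boxStableSubmonoid K L fs).toSubmonoid) :
    x ∈ (boxStableSubmonoid K L fs).toSubmonoid := by
  revert hx
  unfold boxStableSubmonoid
  split_ifs
  · exact mem_triSubmonoid_of_pow_mem K L N hN
  · exact mem_unitsStableSubmonoid_of_pow_mem K L N hN

namespace Def22Context

variable {K} [CharZero K] [Normal K L] [FiniteDimensional K L]
  (H : Subgroup (absoluteGaloisGroup K)) [H.Normal] (hH : IsOpen (H : Set (absoluteGaloisGroup K)))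
  [NeZero N]

/-- **Remark 2.2.1 for `O^□(A) = O^⊳_L`** (`Φ` fieldwise saturated): `SaturatedInvariantsAdmitRoots`
holds for `ofLocalField L H hH (triSubmonoid K L)` whenever `Gal(K̄/L) ≤ H`.
[cite: MochizukiFrdII2008, Rmk 2.2.1 p.18] -/
theorem saturatedInvariantsAdmitRoots_ofLocalField_tri (hHL : galFixing K L ≤ H) :
    SaturatedInvariantsAdmitRoots (ofLocalField L H hH (triSubmonoid K L)) N :=
  saturatedInvariantsAdmitRoots_ofLocalField L H hH (triSubmonoid K L) N hHL
    fun _ hx => mem_triSubmonoid_of_pow_mem K L N (NeZero.pos N) hx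

/-- **Remark 2.2.1 for `O^□(A) = O^×_L`** (`Φ` not fieldwise saturated): `SaturatedInvariantsAdmitRoots`
holds for `ofLocalField L H hH (unitsStableSubmonoid K L)` whenever `Gal(K̄/L) ≤ H`.
[cite: MochizukiFrdII2008, Rmk 2.2.1 p.18] -/
theorem saturatedInvariantsAdmitRoots_ofLocalField_units (hHL : galFixing K L ≤ H) :
    SaturatedInvariantsAdmitRoots (ofLocalField L H hH (unitsStableSubmonoid K L)) N :=
  saturatedInvariantsAdmitRoots_ofLocalField L H hH (unitsStableSubmonoid K L) N hHL
    fun _ hx => mem_unitsStableSubmonoid_of_pow_mem K L N (NeZero.pos N) hx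

/-- **Remark 2.2.1 for `O^□_L`** of Definition 2.2 (iii) (either case).
[cite: MochizukiFrdII2008, Rmk 2.2.1 p.18] -/
theorem saturatedInvariantsAdmitRoots_ofLocalField_box (fs : Prop) (hHL : galFixing K L ≤ H) :
    SaturatedInvariantsAdmitRoots (ofLocalField L H hH (boxStableSubmonoid K L fs)) N :=
  saturatedInvariantsAdmitRoots_ofLocalField L H hH (boxStableSubmonoid K L fs) N hHL
    fun _ hx => mem_boxStableSubmonoid_of_pow_mem K L N fs (NeZero.pos N) hx

end Def22Context

end PadicKummer

end Literature.AlgebraicGeometry.Frobenioids
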